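import Mathlib.GroupTheory.SpecificGroups.Quaternion
import Summits.MatrixMultiplication.OmegaCensus.BoxNotUsefulLift

/-!
# ω-census, family (b3): conjecture C9 — small BAD groups in the kernel: `D₁₄, D₁₆, D₁₈, Q₁₆, Dic₅, Dic₇` are not box-useful (nor is any group mapping onto them)

HONEST FRAMING (pub-omega census; verbatim): lottery ticket; floor = certified bounds/negative ranges.
Census BOOKKEEPING (conjecture C9 of the cell, the '(a)-FORCED by a BAD quotient' mechanism of prereg P-035; pub-omega stpp-1
gen 17): for each of the Mathlib groups `DihedralGroup 7 / 8 / 9` (`D₁₄`, `D₁₆`, `D₁₈`) and `QuaternionGroup 4 / 5 / 7`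
(`Q₁₆`, `Dic₅`, `Dic₇`) an explicit independent cell set of a `3 × 3` box with at least `(9/5)|G|` cells — the cell's engine
(boxmis2 9b0cf7fc, witness mode at `K = ⌈9|G|/5⌉`; sizes `26, 32, 34, 32, 36, 52` for orders `14, 16, 18, 16, 20, 28`) —
checked by `decide`, hence `¬ BoxUseful` for the group (`not_boxUseful_of_indep`) and for every finite group mapping onto it
(`not_boxUseful_of_surjective`, `BoxNotUsefulLift.lean`; `D₁₀` is there).  These are among the BAD sections that force the
64 forced rows of P-035 (D₁₆/Q₁₆, D₁₀/Dic₅, D₁₄/Dic₇, D₁₈, …); a row becomes 'r ≥ 9/5, KERNEL' once its surjection (or, with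
`exists_indep_lift_subgroup`, its embedding) is exhibited.  Nothing here is progress on `ω`.
-/

namespace Summit.MatrixMultiplication.OmegaCensus

open Finset ProductBoxBound

/-! ### `DihedralGroup 7` (order `14`): `26` independent cells `≥ (9/5)·14` -/

/-- The engine's `26`-cell witness of `DihedralGroup 7` in the box `Y = {.r 0, .r 1, .sr 0}`, `W = {.r 0, .r 2, .sr 0}` (as a list). [folklore] -/
def dihedral7WitnessL : List (DihedralGroup 7 × DihedralGroup 7 × DihedralGroup 7) :=
  [(.r 0, .r 1, .r 2), (.r 0, .r 1, .sr 0), (.r 0, .sr 0, .r 0), (.r 2, .sr 0, .r 2), (.r 2, .sr 0, .sr 0),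
    (.r 3, .sr 0, .r 2), (.r 3, .sr 0, .sr 0), (.r 4, .r 0, .r 0), (.r 5, .r 0, .r 0), (.r 5, .r 1, .r 0),
    (.r 6, .r 0, .r 2), (.r 6, .r 0, .sr 0), (.r 6, .r 1, .r 0), (.sr 0, .r 1, .r 2), (.sr 0, .r 1, .sr 0),
    (.sr 0, .sr 0, .r 0), (.sr 1, .r 0, .r 2), (.sr 1, .r 0, .sr 0), (.sr 1, .r 1, .r 0), (.sr 2, .r 0, .r 0),
    (.sr 2, .r 1, .r 0), (.sr 3, .r 0, .r 0), (.sr 4, .sr 0, .r 2), (.sr 4, .sr 0, .sr 0), (.sr 5, .sr 0, .r 2),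
    (.sr 5, .sr 0, .sr 0)]

set_option maxHeartbeats 4000000 in
/-- **`α(DihedralGroup 7; 14, 3, 3) ≥ 26`** (kernel-checked witness; `5·26 ≥ 9·14`). [folklore] -/
theorem dihedral7_exists_indep :
    ∃ (Y W : Finset (DihedralGroup 7)) (I : Finset (DihedralGroup 7 × DihedralGroup 7 × DihedralGroup 7)),
      #Y = 3 ∧ #W = 3 ∧ I ⊆ univ ×ˢ (Y ×ˢ W) ∧ (∀ P ∈ I, ∀ P' ∈ I, P ≠ P' → cellWord P P' ≠ 1) ∧ #I = 26 :=
  ⟨{.r 0, .r 1, .sr 0}, {.r 0, .r 2, .sr 0}, dihedral7WitnessL.toFinset, by decide, by decide,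
    DihC3Sq.subset_box_of_inBoxB (by decide), DihC3Sq.indep_of_indepB (by decide), by decide⟩

/-- **`DihedralGroup 7` is not box-useful**, and neither is any finite group mapping onto it. [folklore] -/
theorem not_boxUseful_of_surjective_dihedral7 {G : Type*} [Group G] [Fintype G] [DecidableEq G]
    (f : G →* DihedralGroup 7) (hf : Function.Surjective f) : ¬ BoxUseful G := by
  obtain ⟨Y, W, I, hY, hW, hI, hind, hcard⟩ := dihedral7_exists_indep
  exact not_boxUseful_of_surjective f hf hY hW hI hind (by rw [DihedralGroup.card]; omega)

/-- **`DihedralGroup 7` is not box-useful.** [folklore] -/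
theorem not_boxUseful_dihedral7 : ¬ BoxUseful (DihedralGroup 7) :=
  not_boxUseful_of_surjective_dihedral7 (MonoidHom.id _) Function.surjective_id

/-! ### `DihedralGroup 8` (order `16`): `32` independent cells `≥ (9/5)·16` -/

/-- The engine's `32`-cell witness of `DihedralGroup 8` in the box `Y = {.r 0, .r 1, .sr 0}`, `W = {.r 0, .r 2, .sr 0}` (as a list). [folklore] -/
def dihedral8WitnessL : List (DihedralGroup 8 × DihedralGroup 8 × DihedralGroup 8) :=
  [(.r 0, .r 0, .r 0), (.r 0, .r 1, .r 2), (.r 0, .r 1, .sr 0), (.r 0, .sr 0, .r 2), (.r 1, .r 1, .r 0),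
    (.r 2, .r 0, .r 2), (.r 3, .r 1, .r 2), (.r 3, .sr 0, .r 2), (.r 3, .sr 0, .sr 0), (.r 4, .r 0, .sr 0),
    (.r 5, .r 0, .r 0), (.r 5, .r 1, .sr 0), (.r 6, .r 1, .r 0), (.r 6, .sr 0, .sr 0), (.r 7, .r 0, .r 2),
    (.r 7, .r 0, .sr 0), (.sr 0, .r 0, .r 0), (.sr 0, .r 1, .r 2), (.sr 0, .r 1, .sr 0), (.sr 0, .sr 0, .r 2),
    (.sr 1, .r 0, .r 2), (.sr 1, .r 0, .sr 0), (.sr 2, .r 1, .r 0), (.sr 2, .sr 0, .sr 0), (.sr 3, .r 0, .r 0),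
    (.sr 3, .r 1, .sr 0), (.sr 4, .r 0, .sr 0), (.sr 5, .r 1, .r 2), (.sr 5, .sr 0, .r 2), (.sr 5, .sr 0, .sr 0),
    (.sr 6, .r 0, .r 2), (.sr 7, .r 1, .r 0)]

set_option maxHeartbeats 4000000 in
/-- **`α(DihedralGroup 8; 16, 3, 3) ≥ 32`** (kernel-checked witness; `5·32 ≥ 9·16`). [folklore] -/
theorem dihedral8_exists_indep :
    ∃ (Y W : Finset (DihedralGroup 8)) (I : Finset (DihedralGroup 8 × DihedralGroup 8 × DihedralGroup 8)),
      #Y = 3 ∧ #W = 3 ∧ I ⊆ univ ×ˢ (Y ×ˢ W) ∧ (∀ P ∈ I, ∀ P' ∈ I, P ≠ P' → cellWord P P' ≠ 1) ∧ #I = 32 :=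
  ⟨{.r 0, .r 1, .sr 0}, {.r 0, .r 2, .sr 0}, dihedral8WitnessL.toFinset, by decide, by decide,
    DihC3Sq.subset_box_of_inBoxB (by decide), DihC3Sq.indep_of_indepB (by decide), by decide⟩

/-- **`DihedralGroup 8` is not box-useful**, and neither is any finite group mapping onto it. [folklore] -/
theorem not_boxUseful_of_surjective_dihedral8 {G : Type*} [Group G] [Fintype G] [DecidableEq G]
    (f : G →* DihedralGroup 8) (hf : Function.Surjective f) : ¬ BoxUseful G := by
  obtain ⟨Y, W, I, hY, hW, hI, hind, hcard⟩ := dihedral8_exists_indep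
  exact not_boxUseful_of_surjective f hf hY hW hI hind (by rw [DihedralGroup.card]; omega)

/-- **`DihedralGroup 8` is not box-useful.** [folklore] -/
theorem not_boxUseful_dihedral8 : ¬ BoxUseful (DihedralGroup 8) :=
  not_boxUseful_of_surjective_dihedral8 (MonoidHom.id _) Function.surjective_id

/-! ### `DihedralGroup 9` (order `18`): `34` independent cells `≥ (9/5)·18` -/

/-- The engine's `34`-cell witness of `DihedralGroup 9` in the box `Y = {.r 0, .r 1, .sr 0}`, `W = {.r 0, .r 2, .sr 0}` (as a list). [folklore] -/
def dihedral9WitnessL : List (DihedralGroup 9 × DihedralGroup 9 × DihedralGroup 9) :=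
  [(.r 0, .r 0, .sr 0), (.r 0, .r 1, .r 2), (.r 0, .r 1, .sr 0), (.r 0, .sr 0, .r 2), (.r 3, .sr 0, .r 2),
    (.r 3, .sr 0, .sr 0), (.r 4, .sr 0, .r 2), (.r 4, .sr 0, .sr 0), (.r 5, .r 0, .r 0), (.r 6, .r 0, .r 0),
    (.r 6, .r 1, .r 0), (.r 7, .r 0, .r 2), (.r 7, .r 1, .r 0), (.r 7, .sr 0, .r 0), (.r 8, .r 0, .r 2),
    (.r 8, .r 0, .sr 0), (.r 8, .r 1, .r 2), (.sr 0, .r 0, .sr 0), (.sr 0, .r 1, .r 2), (.sr 0, .r 1, .sr 0),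
    (.sr 0, .sr 0, .r 2), (.sr 1, .r 0, .r 2), (.sr 1, .r 0, .sr 0), (.sr 1, .r 1, .r 2), (.sr 2, .r 0, .r 2),
    (.sr 2, .r 1, .r 0), (.sr 2, .sr 0, .r 0), (.sr 3, .r 0, .r 0), (.sr 3, .r 1, .r 0), (.sr 4, .r 0, .r 0),
    (.sr 5, .sr 0, .r 2), (.sr 5, .sr 0, .sr 0), (.sr 6, .sr 0, .r 2), (.sr 6, .sr 0, .sr 0)]

set_option maxHeartbeats 4000000 in
/-- **`α(DihedralGroup 9; 18, 3, 3) ≥ 34`** (kernel-checked witness; `5·34 ≥ 9·18`). [folklore] -/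
theorem dihedral9_exists_indep :
    ∃ (Y W : Finset (DihedralGroup 9)) (I : Finset (DihedralGroup 9 × DihedralGroup 9 × DihedralGroup 9)),
      #Y = 3 ∧ #W = 3 ∧ I ⊆ univ ×ˢ (Y ×ˢ W) ∧ (∀ P ∈ I, ∀ P' ∈ I, P ≠ P' → cellWord P P' ≠ 1) ∧ #I = 34 :=
  ⟨{.r 0, .r 1, .sr 0}, {.r 0, .r 2, .sr 0}, dihedral9WitnessL.toFinset, by decide, by decide,
    DihC3Sq.subset_box_of_inBoxB (by decide), DihC3Sq.indep_of_indepB (by decide), by decide⟩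

/-- **`DihedralGroup 9` is not box-useful**, and neither is any finite group mapping onto it. [folklore] -/
theorem not_boxUseful_of_surjective_dihedral9 {G : Type*} [Group G] [Fintype G] [DecidableEq G]
    (f : G →* DihedralGroup 9) (hf : Function.Surjective f) : ¬ BoxUseful G := by
  obtain ⟨Y, W, I, hY, hW, hI, hind, hcard⟩ := dihedral9_exists_indep
  exact not_boxUseful_of_surjective f hf hY hW hI hind (by rw [DihedralGroup.card]; omega)

/-- **`DihedralGroup 9` is not box-useful.** [folklore] -/
theorem not_boxUseful_dihedral9 : ¬ BoxUseful (DihedralGroup 9) :=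
  not_boxUseful_of_surjective_dihedral9 (MonoidHom.id _) Function.surjective_id

/-! ### `QuaternionGroup 4` (order `16`): `32` independent cells `≥ (9/5)·16` -/

/-- The engine's `32`-cell witness of `QuaternionGroup 4` in the box `Y = {.a 0, .a 1, .xa 0}`, `W = {.a 0, .a 2, .xa 0}` (as a list). [folklore] -/
def quaternion4WitnessL : List (QuaternionGroup 4 × QuaternionGroup 4 × QuaternionGroup 4) :=
  [(.a 0, .a 1, .xa 0), (.a 0, .xa 0, .a 2), (.a 1, .a 0, .a 0), (.a 2, .a 1, .a 0), (.a 3, .a 0, .a 2),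
    (.a 3, .xa 0, .a 2), (.a 3, .xa 0, .xa 0), (.a 4, .a 0, .a 0), (.a 4, .a 0, .xa 0), (.a 4, .a 1, .a 2),
    (.a 5, .a 1, .a 0), (.a 5, .a 1, .xa 0), (.a 6, .a 0, .a 2), (.a 6, .xa 0, .xa 0), (.a 7, .a 0, .xa 0),
    (.a 7, .a 1, .a 2), (.xa 0, .a 0, .a 0), (.xa 0, .a 1, .a 2), (.xa 0, .a 1, .xa 0), (.xa 0, .xa 0, .a 2),
    (.xa 1, .a 0, .a 2), (.xa 1, .a 0, .xa 0), (.xa 1, .xa 0, .xa 0), (.xa 2, .a 1, .a 0), (.xa 3, .a 0, .a 0),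
    (.xa 3, .a 1, .xa 0), (.xa 4, .a 0, .xa 0), (.xa 5, .a 1, .a 2), (.xa 5, .xa 0, .a 2), (.xa 6, .a 0, .a 2),
    (.xa 6, .xa 0, .xa 0), (.xa 7, .a 1, .a 0)]

set_option maxHeartbeats 4000000 in
/-- **`α(QuaternionGroup 4; 16, 3, 3) ≥ 32`** (kernel-checked witness; `5·32 ≥ 9·16`). [folklore] -/
theorem quaternion4_exists_indep :
    ∃ (Y W : Finset (QuaternionGroup 4)) (I : Finset (QuaternionGroup 4 × QuaternionGroup 4 × QuaternionGroup 4)),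
      #Y = 3 ∧ #W = 3 ∧ I ⊆ univ ×ˢ (Y ×ˢ W) ∧ (∀ P ∈ I, ∀ P' ∈ I, P ≠ P' → cellWord P P' ≠ 1) ∧ #I = 32 :=
  ⟨{.a 0, .a 1, .xa 0}, {.a 0, .a 2, .xa 0}, quaternion4WitnessL.toFinset, by decide, by decide,
    DihC3Sq.subset_box_of_inBoxB (by decide), DihC3Sq.indep_of_indepB (by decide), by decide⟩

/-- **`QuaternionGroup 4` is not box-useful**, and neither is any finite group mapping onto it. [folklore] -/
theorem not_boxUseful_of_surjective_quaternion4 {G : Type*} [Group G] [Fintype G] [DecidableEq G]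
    (f : G →* QuaternionGroup 4) (hf : Function.Surjective f) : ¬ BoxUseful G := by
  obtain ⟨Y, W, I, hY, hW, hI, hind, hcard⟩ := quaternion4_exists_indep
  exact not_boxUseful_of_surjective f hf hY hW hI hind (by rw [QuaternionGroup.card]; omega)

/-- **`QuaternionGroup 4` is not box-useful.** [folklore] -/
theorem not_boxUseful_quaternion4 : ¬ BoxUseful (QuaternionGroup 4) :=
  not_boxUseful_of_surjective_quaternion4 (MonoidHom.id _) Function.surjective_id

/-! ### `QuaternionGroup 5` (order `20`): `36` independent cells `≥ (9/5)·20` -/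

/-- The engine's `36`-cell witness of `QuaternionGroup 5` in the box `Y = {.a 0, .a 1, .a 2}`, `W = {.a 0, .a 2, .xa 0}` (as a list). [folklore] -/
def quaternion5WitnessL : List (QuaternionGroup 5 × QuaternionGroup 5 × QuaternionGroup 5) :=
  [(.a 0, .a 0, .a 0), (.a 0, .a 0, .xa 0), (.a 0, .a 1, .a 2), (.a 0, .a 1, .xa 0), (.a 1, .a 1, .a 0),
    (.a 1, .a 1, .xa 0), (.a 1, .a 2, .a 2), (.a 1, .a 2, .xa 0), (.a 2, .a 0, .a 2), (.a 2, .a 2, .xa 0),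
    (.a 3, .a 1, .a 2), (.a 3, .a 2, .xa 0), (.a 4, .a 2, .a 2), (.a 4, .a 2, .xa 0), (.a 7, .a 0, .a 0),
    (.a 8, .a 1, .a 0), (.a 9, .a 0, .a 2), (.a 9, .a 0, .xa 0), (.xa 0, .a 0, .xa 0), (.xa 0, .a 1, .xa 0),
    (.xa 1, .a 0, .xa 0), (.xa 3, .a 0, .xa 0), (.xa 3, .a 2, .a 2), (.xa 4, .a 1, .a 2), (.xa 4, .a 2, .a 2),
    (.xa 5, .a 0, .a 2), (.xa 5, .a 1, .a 2), (.xa 6, .a 0, .a 2), (.xa 6, .a 1, .a 0), (.xa 6, .a 2, .xa 0),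
    (.xa 7, .a 0, .a 0), (.xa 7, .a 1, .a 0), (.xa 7, .a 1, .xa 0), (.xa 8, .a 0, .a 0), (.xa 8, .a 0, .xa 0),
    (.xa 9, .a 2, .xa 0)]

set_option maxHeartbeats 4000000 in
/-- **`α(QuaternionGroup 5; 20, 3, 3) ≥ 36`** (kernel-checked witness; `5·36 ≥ 9·20`). [folklore] -/
theorem quaternion5_exists_indep :
    ∃ (Y W : Finset (QuaternionGroup 5)) (I : Finset (QuaternionGroup 5 × QuaternionGroup 5 × QuaternionGroup 5)),
      #Y = 3 ∧ #W = 3 ∧ I ⊆ univ ×ˢ (Y ×ˢ W) ∧ (∀ P ∈ I, ∀ P' ∈ I, P ≠ P' → cellWord P P' ≠ 1) ∧ #I = 36 :=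
  ⟨{.a 0, .a 1, .a 2}, {.a 0, .a 2, .xa 0}, quaternion5WitnessL.toFinset, by decide, by decide,
    DihC3Sq.subset_box_of_inBoxB (by decide), DihC3Sq.indep_of_indepB (by decide), by decide⟩

/-- **`QuaternionGroup 5` is not box-useful**, and neither is any finite group mapping onto it. [folklore] -/
theorem not_boxUseful_of_surjective_quaternion5 {G : Type*} [Group G] [Fintype G] [DecidableEq G]
    (f : G →* QuaternionGroup 5) (hf : Function.Surjective f) : ¬ BoxUseful G := by
  obtain ⟨Y, W, I, hY, hW, hI, hind, hcard⟩ := quaternion5_exists_indep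
  exact not_boxUseful_of_surjective f hf hY hW hI hind (by rw [QuaternionGroup.card]; omega)

/-- **`QuaternionGroup 5` is not box-useful.** [folklore] -/
theorem not_boxUseful_quaternion5 : ¬ BoxUseful (QuaternionGroup 5) :=
  not_boxUseful_of_surjective_quaternion5 (MonoidHom.id _) Function.surjective_id

/-! ### `QuaternionGroup 7` (order `28`): `52` independent cells `≥ (9/5)·28` -/

/-- The engine's `52`-cell witness of `QuaternionGroup 7` in the box `Y = {.a 0, .a 1, .xa 0}`, `W = {.a 0, .a 2, .xa 0}` (as a list). [folklore] -/
def quaternion7WitnessL : List (QuaternionGroup 7 × QuaternionGroup 7 × QuaternionGroup 7) :=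
  [(.a 0, .a 1, .a 0), (.a 0, .a 1, .xa 0), (.a 0, .xa 0, .a 2), (.a 1, .a 0, .a 2), (.a 2, .a 1, .a 2),
    (.a 3, .xa 0, .a 2), (.a 4, .a 0, .a 0), (.a 4, .a 0, .xa 0), (.a 4, .xa 0, .xa 0), (.a 5, .a 1, .a 0),
    (.a 5, .a 1, .xa 0), (.a 6, .a 0, .a 2), (.a 6, .a 1, .xa 0), (.a 7, .a 0, .a 0), (.a 7, .a 1, .a 2),
    (.a 8, .a 1, .a 0), (.a 8, .xa 0, .a 2), (.a 9, .xa 0, .a 2), (.a 9, .xa 0, .xa 0), (.a 11, .a 1, .a 0),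
    (.a 12, .a 0, .a 2), (.a 12, .xa 0, .a 0), (.a 12, .xa 0, .xa 0), (.a 13, .a 0, .a 0), (.a 13, .a 0, .xa 0),
    (.a 13, .a 1, .a 2), (.xa 0, .a 0, .a 0), (.xa 0, .a 1, .a 2), (.xa 0, .a 1, .xa 0), (.xa 0, .xa 0, .a 2),
    (.xa 1, .a 0, .a 2), (.xa 1, .a 0, .xa 0), (.xa 2, .a 1, .a 0), (.xa 2, .xa 0, .a 0), (.xa 3, .a 0, .a 0),
    (.xa 3, .xa 0, .xa 0), (.xa 4, .xa 0, .xa 0), (.xa 5, .a 1, .a 2), (.xa 6, .a 0, .a 2), (.xa 6, .a 1, .xa 0),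
    (.xa 6, .xa 0, .a 2), (.xa 7, .a 0, .a 2), (.xa 7, .a 0, .xa 0), (.xa 7, .a 1, .a 0), (.xa 8, .a 0, .a 0),
    (.xa 8, .a 1, .a 0), (.xa 9, .a 0, .a 0), (.xa 9, .a 1, .xa 0), (.xa 9, .xa 0, .xa 0), (.xa 10, .a 0, .xa 0),
    (.xa 11, .xa 0, .a 2), (.xa 13, .a 1, .a 0)]

set_option maxHeartbeats 4000000 in
/-- **`α(QuaternionGroup 7; 28, 3, 3) ≥ 52`** (kernel-checked witness; `5·52 ≥ 9·28`). [folklore] -/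
theorem quaternion7_exists_indep :
    ∃ (Y W : Finset (QuaternionGroup 7)) (I : Finset (QuaternionGroup 7 × QuaternionGroup 7 × QuaternionGroup 7)),
      #Y = 3 ∧ #W = 3 ∧ I ⊆ univ ×ˢ (Y ×ˢ W) ∧ (∀ P ∈ I, ∀ P' ∈ I, P ≠ P' → cellWord P P' ≠ 1) ∧ #I = 52 :=
  ⟨{.a 0, .a 1, .xa 0}, {.a 0, .a 2, .xa 0}, quaternion7WitnessL.toFinset, by decide, by decide,
    DihC3Sq.subset_box_of_inBoxB (by decide), DihC3Sq.indep_of_indepB (by decide), by decide⟩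

/-- **`QuaternionGroup 7` is not box-useful**, and neither is any finite group mapping onto it. [folklore] -/
theorem not_boxUseful_of_surjective_quaternion7 {G : Type*} [Group G] [Fintype G] [DecidableEq G]
    (f : G →* QuaternionGroup 7) (hf : Function.Surjective f) : ¬ BoxUseful G := by
  obtain ⟨Y, W, I, hY, hW, hI, hind, hcard⟩ := quaternion7_exists_indep
  exact not_boxUseful_of_surjective f hf hY hW hI hind (by rw [QuaternionGroup.card]; omega)

/-- **`QuaternionGroup 7` is not box-useful.** [folklore] -/
theorem not_boxUseful_quaternion7 : ¬ BoxUseful (QuaternionGroup 7) :=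
  not_boxUseful_of_surjective_quaternion7 (MonoidHom.id _) Function.surjective_id

end Summit.MatrixMultiplication.OmegaCensus
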